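import Summits.QuantumFields.BalabanUV.Beta.GAN24.WoodburyFibreProjector
import Summits.QuantumFields.BalabanUV.Beta.GAN24.WoodburyFibreProjectorZd

/-!
# Beta / GAN24 / WoodburyFibreProjectorZdDecay — census row V11, `ℤ^{d+1}` half (estimate): `1 − R` for an2's `R(1) = L·Sb·L` is
`O(N^{−(d+1)})·e^{−δ·(block distance)}` UNIFORMLY ALONG THE SCALES `N = L^k`

Cell `pub-balaban`, β sub-cell, BINDER ROW **G-an2-4 ∕ (CONV-C)** («NOT IN PRINT; our proof attempt»), prover part **P3 = WOODBURY-FIBRE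
reduction** (lineage `b2b-balaban-gan24-p3`, gen 7).  HONEST FRAMING (verbatim): discharging `BetaPertH` makes Bałaban's UV stability
UNCONDITIONAL — a real constructive-QFT result; it is NOT the continuum limit and NOT the Clay problem.  HONEST DEPENDENCY: continuum YM
on T⁴ ⇐ BetaPertH ∧ nine spine estimates (0/9 proved); BetaPertH ⇐ (D1) ∧ (D4) ∧ CAP+tail; G-an2-4 gates asym, D1 and NE2/3/4.
`[folklore]`; 0 sorry; an2's files imported and used BY NAME; nothing printed and nothing programme-internal is a hypothesis.
NOT (CONV-C), NOT «G-an2-4 closed», NOT `BetaPertH`.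

STATEMENT (`Rb_decay_uniform`): for every `d` and `L = ℓ+1 ≥ 2` there are `δ, C > 0` with
`|δ_{xx′} − Rb N x x′| ≤ C·N^{−(d+1)}·e^{−δ|quo_N x − quo_N x′|_∞}` for EVERY `k ≥ 1`, `N = L^k` and all `x, x′ ∈ ℤ^{d+1}` (the natural size of
the rank-`#blocks`-per-volume projector `1 − R` onto the minimiser columns), and the cube form `blockSum_N |δ_{x·} − Rb N x ·| b′ ≤
C·e^{−δ|quo_N x − b′|_∞}` (`Rb_blockSum_decay_uniform`); `(δ, C)` are those of `WoodburyFibreProjector.one_sub_projR_decay` (B4 (1.10) on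
boxes `B4Thm110ZeroBox` + box (2.76) coercivity `qGq_box_coercive`, by name).  PRINT LOCATOR (NOT a hypothesis; this file REPRODUCES its
`U = 1`, one-domain, `P`-entry case on `ℤ^{d+1}`): [B9] T. Bałaban, CMP **99** (1985) p. 399 (3.49), journal render re-read by this seat:
«For the operator P = I − R we obtain, using again Lemma 2.1, [|P(x,x′)|, |(DP)_μ(x,x′)|, |(PD*)_ν(x,x′)|, |(DPD*)_{μν}(x,x′)|] ≤
O(1)[1, (L^jη)^{−1}, (L^jη)^{−1}, (L^jη)^{−2}](L^{j′}η)^{−d} e^{−(1/2)δ₀d(y,y′)} for x ∈ Δ(y), y ∈ Λ_j, x′ ∈ Δ(y′), y′ ∈ Λ_{j′}.» — the factor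
`(L^{j′}η)^{−d}` = (block volume)⁻¹ is the `N^{−(d+1)}` below; the derivative entries `DP`, `PD*`, `DPD*` are NOT treated here.
PROOF = gen 6's box exhaustion: along the re-centred Neumann
boxes `[−Rn, Rn)^{d+1}` the kernels `K_R` converge to `Sb` pointwise on a subsequence (`exists_subseq_tendsto_Sb` — gen 6's identification
via an2's `eq_Sb_of_solvesB`, re-run to export the convergence), at interior points `L_x L_{x′} K_R` IS Bałaban's box projection `projR`
(`lap2_KR_eq`, by `boxLap_interior` on each variable), and `1 − projR` obeys the scale-uniform entrywise bound of `WoodburyFibreProjector`.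
-/

namespace Summit.QuantumFields.BalabanUV.Beta.GAN24.WoodburyFibreProjectorZdDecay

open Filter Topology Finset Matrix
open Literature.MathematicalPhysics.QuantumFieldTheory
open Literature.MathematicalPhysics.QuantumFieldTheory.Balaban1983to89
open B4ContourShift (supNorm supNorm_nonneg abs_le_supNorm)
open B4Reflection242 (boxDom mem_boxDom blk nbrs mem_nbrs supNorm_le_of_forall)
open B4BoxCov237 (boxOpR indB rho extB extB_of_mem extB_of_not_mem opBoxR boxOpR_isSymm)
open B5Decay126 (PosDecay)
open Beta.AffineAveraging (dz codiff₁ unitVec box toSite blockSum)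
open Beta.KKTFluctuationUnique (Tempered0 Tempered0.of_bounded)
open Beta.KKTFluctuationEnergy (quo_zsmul_add_toSite)
open Beta.ScalarBlockGreen (δS)
open Beta.BiLaplaceBlockKKT (Sb)
open Beta.BiLaplaceBlockGreen (SolvesB eq_Sb_of_solvesB)
open LatticeForm (quo)
open WoodburyFibreGaugeCubeDecay (CubeDecay)
open WoodburyFibreBoxQGQ (fineN blkBox blkBox_val)
open WoodburyFibreLandauBox (landau_box_cubeDecay_indB)
open WoodburyFibreLandauLimit
open WoodburyFibreLandauZd (KR KR_abs_le KR_row_eq lapSq_KR_eq blockSum_KR_eq_zero quo_eq_blk blk_zsmul)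
open WoodburyFibreProjector (projR one_sub_projR_decay)
open WoodburyFibreProjectorZd (Rb)

noncomputable section

variable {d : ℕ}

/-! ## §1 The box kernels converge to `Sb`; the interior identity -/

/-- **the box kernels converge to `Sb` on a subsequence** (gen 6's identification, re-run to export the convergence): if the box Landau
operators on all cubes `[0, 2Rn)^{d+1}` obey one cube-decay bound, some subsequence of the re-centred kernels `K_R` converges pointwise
to an2's `Sb`. [folklore] -/
theorem exists_subseq_tendsto_Sb {n : ℕ} [NeZero n] (hn : 1 ≤ n) {C δ : ℝ} (hδ : 0 ≤ δ)
    (hbox : ∀ R, 1 ≤ R → CubeDecay (rho (cubeM d R)) (blkBox hn (cubeM d R)) id (landauCov n (cubeM d R)) C δ) :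
    ∃ φ : ℕ → ℕ, StrictMono φ ∧ ∀ z x' : Fin (d + 1) → ℤ, Tendsto (fun R => KR n (φ R + 1) z x') atTop (𝓝 (Sb (N := n) z x')) := by
  have hC : 0 ≤ C := (hbox 1 le_rfl).1
  obtain ⟨g, φ, hφ, hlim, hbd⟩ := exists_subseq_pointwise_limit
    (fun R (p : (Fin (d + 1) → ℤ) × (Fin (d + 1) → ℤ)) => KR n (R + 1) p.1 p.2)
    (fun p => (n : ℝ) ^ 4 * C * Real.exp (-(δ * supNorm (blk n p.1 - blk n p.2))))
    (fun R p => KR_abs_le hn (hbox (R + 1) (by omega)) p.1 p.2)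
  have hφge : ∀ R, R ≤ φ R := fun R => hφ.id_le R
  have hself : ∀ z : Fin (d + 1) → ℤ, supNorm (z - z) ≤ 2 := fun z => by
    rw [sub_self]; exact supNorm_le_of_forall fun j => by simp
  refine ⟨φ, hφ, fun z₀ x' => ?_⟩
  set lam : (Fin (d + 1) → ℤ) → ℝ := fun z => g (z, x') with hlamdef
  have hlimz : ∀ z, Tendsto (fun R => KR n (φ R + 1) z x') atTop (𝓝 (lam z)) := fun z => hlim (z, x')
  have hlam_bd : ∀ z, |lam z| ≤ (n : ℝ) ^ 4 * C := by
    intro z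
    have h1 := hbd (z, x')
    have h2 : Real.exp (-(δ * supNorm (blk n z - blk n x'))) ≤ 1 :=
      Real.exp_le_one_iff.2 (by nlinarith [supNorm_nonneg (blk n z - blk n x')])
    calc |lam z| ≤ (n : ℝ) ^ 4 * C * Real.exp (-(δ * supNorm (blk n z - blk n x'))) := h1
      _ ≤ (n : ℝ) ^ 4 * C * 1 := mul_le_mul_of_nonneg_left h2 (by positivity)
      _ = _ := mul_one _
  have hLL : ∀ z, Tendsto (fun R => codiff₁ (dz (codiff₁ (dz (fun w => KR n (φ R + 1) w x')))) z) atTop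
      (𝓝 (codiff₁ (dz (codiff₁ (dz lam))) z)) := tendsto_lap (tendsto_lap hlimz)
  have hbc : ∀ z₁ z₂, blk n z₁ = blk n z₂ →
      codiff₁ (dz (codiff₁ (dz lam))) z₁ - δS x' z₁ = codiff₁ (dz (codiff₁ (dz lam))) z₂ - δS x' z₂ := by
    intro z₁ z₂ hb
    obtain ⟨R₁, hR₁⟩ := eventually_two_nbhd (d := d) hn z₁
    obtain ⟨R₂, hR₂⟩ := eventually_two_nbhd (d := d) hn z₂
    obtain ⟨R₃, hR₃⟩ := eventually_two_nbhd (d := d) hn x'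
    have hev : ∀ᶠ R in atTop,
        (codiff₁ (dz (codiff₁ (dz (fun w => KR n (φ R + 1) w x')))) z₁ - δS x' z₁)
          - (codiff₁ (dz (codiff₁ (dz (fun w => KR n (φ R + 1) w x')))) z₂ - δS x' z₂) = 0 := by
      refine Filter.eventually_atTop.2 ⟨R₁ + R₂ + R₃, fun R hR => ?_⟩
      have hge := hφge R
      have h2₁ := hR₁ (φ R + 1) (by omega)
      have h2₂ := hR₂ (φ R + 1) (by omega)
      have hx'm := hR₃ (φ R + 1) (by omega) x' (hself x')
      rw [lapSq_KR_eq hn (by omega) h2₁ (h2₁ z₁ (hself z₁)) hx'm, lapSq_KR_eq hn (by omega) h2₂ (h2₂ z₂ (hself z₂)) hx'm]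
      have hbb : blkBox hn (cubeM d (φ R + 1)) ⟨z₁ + shiftF d n (φ R + 1), h2₁ z₁ (hself z₁)⟩
          = blkBox hn (cubeM d (φ R + 1)) ⟨z₂ + shiftF d n (φ R + 1), h2₂ z₂ (hself z₂)⟩ :=
        Subtype.ext (by simp only [blkBox_val, blk_add_shiftF hn, hb])
      rw [hbb]
      simp only [δS]
      ring
    have hconv : Tendsto (fun R =>
        (codiff₁ (dz (codiff₁ (dz (fun w => KR n (φ R + 1) w x')))) z₁ - δS x' z₁)
          - (codiff₁ (dz (codiff₁ (dz (fun w => KR n (φ R + 1) w x')))) z₂ - δS x' z₂)) atTop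
        (𝓝 ((codiff₁ (dz (codiff₁ (dz lam))) z₁ - δS x' z₁) - (codiff₁ (dz (codiff₁ (dz lam))) z₂ - δS x' z₂))) :=
      ((hLL z₁).sub_const _).sub ((hLL z₂).sub_const _)
    have huniq := tendsto_nhds_unique hconv (tendsto_const_nhds.congr' (hev.mono fun R h => h.symm))
    linarith
  set ω : (Fin (d + 1) → ℤ) → ℝ := fun y => codiff₁ (dz (codiff₁ (dz lam))) ((n : ℤ) • y) - δS x' ((n : ℤ) • y) with hωdef
  have hel : ∀ z, codiff₁ (dz (codiff₁ (dz lam))) z = ω (quo n z) + δS x' z := by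
    intro z
    have h := hbc z ((n : ℤ) • quo n z) (by rw [quo_eq_blk, blk_zsmul hn])
    rw [hωdef]
    linarith
  have hmean : ∀ y, blockSum n lam y = 0 := by
    intro y
    obtain ⟨R₁, hR₁⟩ := eventually_block (d := d) hn y
    obtain ⟨R₃, hR₃⟩ := eventually_two_nbhd (d := d) hn x'
    have hev : ∀ᶠ R in atTop, blockSum n (fun z => KR n (φ R + 1) z x') y = 0 := by
      refine Filter.eventually_atTop.2 ⟨R₁ + R₃, fun R hR => ?_⟩
      have hge := hφge R
      exact blockSum_KR_eq_zero hn (by omega) (hR₁ (φ R + 1) (by omega)).1 (hR₃ (φ R + 1) (by omega) x' (hself x'))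
    have hconv : Tendsto (fun R => blockSum n (fun z => KR n (φ R + 1) z x') y) atTop (𝓝 (blockSum n lam y)) := by
      unfold blockSum
      exact tendsto_finsetSum _ fun b _ => hlimz _
    exact tendsto_nhds_unique hconv (tendsto_const_nhds.congr' (hev.mono fun R h => h.symm))
  have hsol : SolvesB n (δS x') 0 lam ω := ⟨hel, fun y => by rw [Pi.zero_apply]; exact hmean y⟩
  have hlamT : Tempered0 lam := Tempered0.of_bounded hlam_bd
  have hωT : Tempered0 ω := by
    refine Tempered0.of_bounded (B := 4 * ((d : ℝ) + 1) * (4 * ((d : ℝ) + 1) * ((n : ℝ) ^ 4 * C)) + 1) fun y => ?_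
    have h1 : ∀ z, |codiff₁ (dz lam) z| ≤ 4 * ((d : ℝ) + 1) * ((n : ℝ) ^ 4 * C) := fun z => abs_lap_le z hlam_bd
    have h2 := abs_lap_le ((n : ℤ) • y) h1
    have h3 : |δS x' ((n : ℤ) • y)| ≤ 1 := by simp only [δS]; split_ifs <;> simp
    rw [hωdef]
    calc |codiff₁ (dz (codiff₁ (dz lam))) ((n : ℤ) • y) - δS x' ((n : ℤ) • y)|
        ≤ |codiff₁ (dz (codiff₁ (dz lam))) ((n : ℤ) • y)| + |δS x' ((n : ℤ) • y)| := abs_sub _ _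
      _ ≤ _ := add_le_add h2 h3
  have hid : lam z₀ = Sb (N := n) z₀ x' := eq_Sb_of_solvesB hsol hlamT hωT z₀
  rw [← hid]
  exact hlimz z₀

/-- neighbours translate: `z ∈ nbrs (x + t) → z − t ∈ nbrs x`. [folklore] -/
theorem sub_mem_nbrs_of_mem_nbrs_add {x t z : Fin (d + 1) → ℤ} (hz : z ∈ nbrs (x + t)) : z - t ∈ nbrs x := by
  obtain ⟨i, h | h⟩ := mem_nbrs.1 hz
  · exact mem_nbrs.2 ⟨i, Or.inl (by rw [h]; abel)⟩
  · exact mem_nbrs.2 ⟨i, Or.inr (by rw [h]; abel)⟩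

/-- interiority of a point and of its nearest neighbours from the `2`-neighbourhood condition (shifted form). [folklore] -/
theorem interior_of_two_nbhd_shift {n R : ℕ} {x : Fin (d + 1) → ℤ}
    (h2 : ∀ z, supNorm (z - x) ≤ 2 → z + shiftF d n R ∈ boxDom (fineN n (cubeM d R))) :
    x + shiftF d n R ∈ boxDom (fineN n (cubeM d R)) ∧ ∀ z ∈ nbrs x, z + shiftF d n R ∈ boxDom (fineN n (cubeM d R)) :=
  ⟨h2 x (by rw [sub_self]; exact supNorm_le_of_forall fun j => by simp),
    fun z hz => h2 z ((supNorm_sub_le_one_of_mem_nbrs hz).trans (by norm_num))⟩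

/-- a row of a matrix as a vector: `(A *ᵥ (B i ·)) j = (B·Aᵀ) i j`. [folklore] -/
theorem mulVec_row {p q : Type*} [Fintype q] (A : Matrix q q ℝ) (B : Matrix p q ℝ) (i : p) (j : q) :
    (A *ᵥ fun w => B i w) j = (B * Aᵀ) i j := by
  simp [Matrix.mulVec, Matrix.mul_apply, dotProduct, mul_comm]

/-- **THE INTERIOR IDENTITY**: at points `x, x′` whose nearest neighbours lie, after the shift, in the cube, the two-variable Laplacian of
`K_R` is Bałaban's box projection: `L_x L_{x′} K_R (x, x′) = projR n (cubeM d R) (x + Rn𝟙) (x′ + Rn𝟙)`. [folklore] -/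
theorem lap2_KR_eq {n : ℕ} (hn : 1 ≤ n) {R : ℕ} {x x' : Fin (d + 1) → ℤ}
    (hx : x + shiftF d n R ∈ boxDom (fineN n (cubeM d R)))
    (hx1 : ∀ z ∈ nbrs x, z + shiftF d n R ∈ boxDom (fineN n (cubeM d R)))
    (hx' : x' + shiftF d n R ∈ boxDom (fineN n (cubeM d R)))
    (hx'1 : ∀ z ∈ nbrs x', z + shiftF d n R ∈ boxDom (fineN n (cubeM d R))) :
    codiff₁ (dz (fun z => codiff₁ (dz (fun w => KR n R z w)) x')) x
      = projR n (cubeM d R) ⟨x + shiftF d n R, hx⟩ ⟨x' + shiftF d n R, hx'⟩ := by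
  have hn0 : (n : ℝ) ≠ 0 := by exact_mod_cast (by omega : n ≠ 0)
  have hL : boxOpR n 0 0 (cubeM d R) = opBoxR ((n : ℝ) ^ 2) 0 0 n (fineN n (cubeM d R)) := by simp only [boxOpR, zero_mul]
  have hLt : (boxOpR n 0 0 (cubeM d R))ᵀ = boxOpR n 0 0 (cubeM d R) := boxOpR_isSymm n 0 0 (cubeM d R)
  -- interiority of the shifted points
  have hint' : ∀ z ∈ nbrs (x' + shiftF d n R), z ∈ boxDom (fineN n (cubeM d R)) := fun z hz => by
    have := hx'1 (z - shiftF d n R) (sub_mem_nbrs_of_mem_nbrs_add hz); rwa [sub_add_cancel] at this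
  have hint : ∀ z ∈ nbrs (x + shiftF d n R), z ∈ boxDom (fineN n (cubeM d R)) := fun z hz => by
    have := hx1 (z - shiftF d n R) (sub_mem_nbrs_of_mem_nbrs_add hz); rwa [sub_add_cancel] at this
  -- Step A: the inner Laplacian is `n²·` the column `(Γ·L_n)(·, x′ + c)`, extended by zero
  have hA : ∀ z, codiff₁ (dz (fun w => KR n R z w)) x' = (n : ℝ) ^ 2 * extB (fineN n (cubeM d R))
      (fun v => (landauCov n (cubeM d R) * boxOpR n 0 0 (cubeM d R)) v ⟨x' + shiftF d n R, hx'⟩) (z + shiftF d n R) := by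
    intro z
    by_cases hz : z + shiftF d n R ∈ boxDom (fineN n (cubeM d R))
    · have hrow : (fun w => KR n R z w) = fun w => (n : ℝ) ^ 4 * extB (fineN n (cubeM d R))
          (fun w' => landauCov n (cubeM d R) ⟨z + shiftF d n R, hz⟩ w') (w + shiftF d n R) := funext fun w => KR_row_eq hz w
      have e1 : codiff₁ (dz (fun w => KR n R z w)) x' = codiff₁ (dz (fun w' => (n : ℝ) ^ 4 * extB (fineN n (cubeM d R))
          (fun w' => landauCov n (cubeM d R) ⟨z + shiftF d n R, hz⟩ w') w')) (x' + shiftF d n R) := by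
        rw [hrow]
        exact lap_translate (fun w' => (n : ℝ) ^ 4 * extB (fineN n (cubeM d R))
          (fun w' => landauCov n (cubeM d R) ⟨z + shiftF d n R, hz⟩ w') w') (shiftF d n R) x'
      have hB := boxLap_interior ((n : ℝ) ^ 2) n (fun w' => landauCov n (cubeM d R) ⟨z + shiftF d n R, hz⟩ w')
        ⟨x' + shiftF d n R, hx'⟩ hint'
      rw [← hL, mulVec_row, hLt] at hB
      dsimp only at hB
      rw [e1, lap_smul, extB_of_mem _ hz, show ((n : ℝ) ^ 4 : ℝ) = (n : ℝ) ^ 2 * (n : ℝ) ^ 2 by ring, mul_assoc, ← hB]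
    · have hzero : (fun w => KR n R z w) = fun _ => 0 := by
        funext w; unfold KR; rw [dif_neg (fun h => hz h.1)]
      rw [hzero, extB_of_not_mem _ hz, mul_zero, lap_apply]
      simp
  -- Step B: the outer Laplacian
  have hstep : codiff₁ (dz (fun z => codiff₁ (dz (fun w => KR n R z w)) x')) x
      = (n : ℝ) ^ 2 * codiff₁ (dz (extB (fineN n (cubeM d R))
          (fun v => (landauCov n (cubeM d R) * boxOpR n 0 0 (cubeM d R)) v ⟨x' + shiftF d n R, hx'⟩))) (x + shiftF d n R) := by
    rw [show (fun z => codiff₁ (dz (fun w => KR n R z w)) x') = _ from funext hA]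
    exact (lap_translate (fun z' => (n : ℝ) ^ 2 * extB (fineN n (cubeM d R))
      (fun v => (landauCov n (cubeM d R) * boxOpR n 0 0 (cubeM d R)) v ⟨x' + shiftF d n R, hx'⟩) z') (shiftF d n R) x).trans
      (lap_smul _ _ _)
  have hB := boxLap_interior ((n : ℝ) ^ 2) n
    (fun v => (landauCov n (cubeM d R) * boxOpR n 0 0 (cubeM d R)) v ⟨x' + shiftF d n R, hx'⟩) ⟨x + shiftF d n R, hx⟩ hint
  rw [← hL, mulVec_col] at hB
  dsimp only at hB
  rw [hstep, ← hB, projR, Matrix.mul_assoc]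

/-! ## §2 `1 − R` is small and decays, uniformly along the scales -/

/-- **ONE SCALE**: a cube-decay bound of the box Landau operators (for the existence of the limit) and an entrywise bound of `1 − projR` on
all re-centred cubes give `|δ_{xx′} − Rb n x x′| ≤ C·e^{−δ|blk x − blk x′|_∞}`. [folklore] -/
theorem Rb_decay_of_box {n : ℕ} [NeZero n] (hn : 1 ≤ n) {C₀ δ₀ C δ : ℝ} (hδ₀ : 0 ≤ δ₀)
    (hbox : ∀ R, 1 ≤ R → CubeDecay (rho (cubeM d R)) (blkBox hn (cubeM d R)) id (landauCov n (cubeM d R)) C₀ δ₀)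
    (hP : ∀ R, 1 ≤ R → PosDecay (rho (cubeM d R)) (id ∘ blkBox hn (cubeM d R)) (id ∘ blkBox hn (cubeM d R))
      (1 - projR n (cubeM d R)) C δ) (x x' : Fin (d + 1) → ℤ) :
    |(if x = x' then 1 else 0) - Rb n x x'| ≤ C * Real.exp (-(δ * supNorm (blk n x - blk n x'))) := by
  obtain ⟨φ, hφ, hlim⟩ := exists_subseq_tendsto_Sb hn hδ₀ hbox
  have hφge : ∀ R, R ≤ φ R := fun R => hφ.id_le R
  -- the two-variable Laplacians converge
  have hconv : Tendsto (fun R => codiff₁ (dz (fun z => codiff₁ (dz (fun w => KR n (φ R + 1) z w)) x')) x) atTop (𝓝 (Rb n x x')) :=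
    tendsto_lap (fun z => tendsto_lap (fun w => hlim z w) x') x
  -- eventually they are the box projection, with the uniform bound
  obtain ⟨R₁, hR₁⟩ := eventually_two_nbhd (d := d) hn x
  obtain ⟨R₂, hR₂⟩ := eventually_two_nbhd (d := d) hn x'
  have hev : ∀ᶠ R in atTop, |(if x = x' then 1 else 0) - codiff₁ (dz (fun z => codiff₁ (dz (fun w => KR n (φ R + 1) z w)) x')) x|
      ≤ C * Real.exp (-(δ * supNorm (blk n x - blk n x'))) := by
    refine Filter.eventually_atTop.2 ⟨R₁ + R₂, fun R hR => ?_⟩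
    have hge := hφge R
    obtain ⟨hxm, hxn⟩ := interior_of_two_nbhd_shift (hR₁ (φ R + 1) (by omega))
    obtain ⟨hx'm, hx'n⟩ := interior_of_two_nbhd_shift (hR₂ (φ R + 1) (by omega))
    rw [lap2_KR_eq hn hxm hxn hx'm hx'n]
    have h := (hP (φ R + 1) (by omega)).2 ⟨x + shiftF d n (φ R + 1), hxm⟩ ⟨x' + shiftF d n (φ R + 1), hx'm⟩
    have hdist : rho (cubeM d (φ R + 1)) ((id ∘ blkBox hn (cubeM d (φ R + 1))) ⟨x + shiftF d n (φ R + 1), hxm⟩)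
        ((id ∘ blkBox hn (cubeM d (φ R + 1))) ⟨x' + shiftF d n (φ R + 1), hx'm⟩) = supNorm (blk n x - blk n x') := by
      simp only [Function.comp_apply, id, rho, blkBox_val, blk_add_shiftF hn, add_sub_add_right_eq_sub]
    rw [hdist, Matrix.sub_apply, Matrix.one_apply] at h
    have hiff : ((⟨x + shiftF d n (φ R + 1), hxm⟩ : ↥(boxDom (fineN n (cubeM d (φ R + 1))))) = ⟨x' + shiftF d n (φ R + 1), hx'm⟩)
        ↔ x = x' := by
      rw [Subtype.ext_iff]; exact add_left_inj _
    by_cases hxx : x = x'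
    · rw [if_pos hxx]; rw [if_pos (hiff.2 hxx)] at h; exact h
    · rw [if_neg hxx]; rw [if_neg (fun e => hxx (hiff.1 e))] at h; exact h
  exact le_of_tendsto ((tendsto_const_nhds.sub hconv).abs) hev

/-- **`1 − R` IS `O(N^{−(d+1)})` AND DECAYS IN BLOCK UNITS, UNIFORMLY ALONG THE SCALES** (census row V11, `ℤ^{d+1}` half): for every
`d` and `L = ℓ+1 ≥ 2` there are `δ, C > 0` with `|δ_{xx′} − Rb N x x′| ≤ C·N^{−(d+1)}·e^{−δ|quo_N x − quo_N x′|_∞}` for EVERY `k ≥ 1`,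
`N = L^k` and all `x, x′ ∈ ℤ^{d+1}` — the natural size of the rank-`#blocks`-per-volume projector `1 − R` onto the minimiser columns;
`(δ, C)` are those of `WoodburyFibreProjector.one_sub_projR_decay` (B4 (1.10) on boxes + box (2.76) coercivity, by name). [folklore] -/
theorem Rb_decay_uniform (d ℓ : ℕ) (hℓ : 1 ≤ ℓ) :
    ∃ δ C : ℝ, 0 < δ ∧ 0 < C ∧ ∀ (k : ℕ), 1 ≤ k → ∀ x x' : Fin (d + 1) → ℤ,
      |(if x = x' then 1 else 0) - @Rb d ((ℓ + 1) ^ k) ⟨Nat.pos_iff_ne_zero.1 (Nat.one_le_pow k (ℓ + 1) (Nat.succ_pos ℓ))⟩ x x'|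
        ≤ C * ((((ℓ + 1) ^ k : ℕ) : ℝ) ^ (d + 1))⁻¹ * Real.exp (-(δ * supNorm (quo ((ℓ + 1) ^ k) x - quo ((ℓ + 1) ^ k) x'))) := by
  obtain ⟨δ₀, C₀, hδ₀, hC₀, h₀⟩ := landau_box_cubeDecay_indB d ℓ hℓ (m2plus := 0) le_rfl
  obtain ⟨δ, C, hδ, hC, h⟩ := one_sub_projR_decay d ℓ hℓ
  refine ⟨δ, C, hδ, hC, fun k hk x x' => ?_⟩
  have hn : 1 ≤ (ℓ + 1) ^ k := Nat.one_le_pow k (ℓ + 1) (Nat.succ_pos ℓ)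
  haveI : NeZero ((ℓ + 1) ^ k) := ⟨Nat.pos_iff_ne_zero.1 hn⟩
  have hbox : ∀ R, 1 ≤ R →
      CubeDecay (rho (cubeM d R)) (blkBox hn (cubeM d R)) id (landauCov ((ℓ + 1) ^ k) (cubeM d R)) C₀ δ₀ := fun R hR =>
    h₀ k hk 0 le_rfl le_rfl (cubeM d R) (fun i => by simp only [cubeM]; omega) 1 one_pos
  have hP : ∀ R, 1 ≤ R → PosDecay (rho (cubeM d R)) (id ∘ blkBox hn (cubeM d R)) (id ∘ blkBox hn (cubeM d R))
      (1 - projR ((ℓ + 1) ^ k) (cubeM d R)) (C * ((((ℓ + 1) ^ k : ℕ) : ℝ) ^ (d + 1))⁻¹) δ := fun R hR =>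
    (h k hk (cubeM d R) (fun i => by simp only [cubeM]; omega)).1
  have hmain := Rb_decay_of_box hn hδ₀.le hbox hP x x'
  rw [quo_eq_blk, quo_eq_blk]
  convert hmain using 2

/-- **THE SAME IN BAŁABAN'S CUBE CURRENCY**: `blockSum_N |δ_{x·} − Rb N x ·| b′ ≤ C·e^{−δ|quo_N x − b′|_∞}` for every `k ≥ 1`, `N = L^k`
(sum the entrywise bound over the `N^{d+1}` sites of the block). [folklore] -/
theorem Rb_blockSum_decay_uniform (d ℓ : ℕ) (hℓ : 1 ≤ ℓ) :
    ∃ δ C : ℝ, 0 < δ ∧ 0 < C ∧ ∀ (k : ℕ), 1 ≤ k → ∀ x b' : Fin (d + 1) → ℤ,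
      blockSum ((ℓ + 1) ^ k) (fun y => |(if x = y then 1 else 0)
        - @Rb d ((ℓ + 1) ^ k) ⟨Nat.pos_iff_ne_zero.1 (Nat.one_le_pow k (ℓ + 1) (Nat.succ_pos ℓ))⟩ x y|) b'
        ≤ C * Real.exp (-(δ * supNorm (quo ((ℓ + 1) ^ k) x - b'))) := by
  obtain ⟨δ, C, hδ, hC, h⟩ := Rb_decay_uniform d ℓ hℓ
  refine ⟨δ, C, hδ, hC, fun k hk x b' => ?_⟩
  have hn : 1 ≤ (ℓ + 1) ^ k := Nat.one_le_pow k (ℓ + 1) (Nat.succ_pos ℓ)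
  haveI : NeZero ((ℓ + 1) ^ k) := ⟨Nat.pos_iff_ne_zero.1 hn⟩
  have hN : (0 : ℝ) < (((ℓ + 1) ^ k : ℕ) : ℝ) ^ (d + 1) := by positivity
  unfold blockSum
  calc ∑ b ∈ box (d + 1) ((ℓ + 1) ^ k), |(if x = ((((ℓ + 1) ^ k : ℕ) : ℤ) • b' + toSite b) then 1 else 0)
        - Rb ((ℓ + 1) ^ k) x (((((ℓ + 1) ^ k : ℕ) : ℤ)) • b' + toSite b)|
      ≤ ∑ _b ∈ box (d + 1) ((ℓ + 1) ^ k), C * ((((ℓ + 1) ^ k : ℕ) : ℝ) ^ (d + 1))⁻¹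
          * Real.exp (-(δ * supNorm (quo ((ℓ + 1) ^ k) x - b'))) := by
        refine Finset.sum_le_sum fun b hb => ?_
        have := h k hk x (((((ℓ + 1) ^ k : ℕ) : ℤ)) • b' + toSite b)
        rwa [quo_zsmul_add_toSite b' hb] at this
    _ = C * Real.exp (-(δ * supNorm (quo ((ℓ + 1) ^ k) x - b'))) := by
        -- `#box = N^{d+1}` (the count is `Literature.Algebra.EuclideanLattices.Regev2004.card_box`; kept as a local `have`)
        have hcard : (box (d + 1) ((ℓ + 1) ^ k)).card = ((ℓ + 1) ^ k) ^ (d + 1) := by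
          simp [Beta.AffineAveraging.box, Fintype.card_piFinset, Finset.card_range, Finset.prod_const, Finset.card_univ,
            Fintype.card_fin]
        rw [Finset.sum_const, hcard, nsmul_eq_mul]; push_cast; field_simp

/-! ## §3 Non-vacuity: the physical case `d + 1 = 4`, `L = 2` -/

/-- `Rb_decay_uniform` at `d + 1 = 4`, `L = 2`; the prefix is inhabited (`k = 1`, `x = x′ = 0`). -/
example : ∃ δ C : ℝ, 0 < δ ∧ 0 < C ∧ ∀ (k : ℕ), 1 ≤ k → ∀ x x' : Fin (3 + 1) → ℤ,
      |(if x = x' then 1 else 0) - @Rb 3 ((1 + 1) ^ k) ⟨Nat.pos_iff_ne_zero.1 (Nat.one_le_pow k (1 + 1) (Nat.succ_pos 1))⟩ x x'|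
        ≤ C * ((((1 + 1) ^ k : ℕ) : ℝ) ^ (3 + 1))⁻¹ * Real.exp (-(δ * supNorm (quo ((1 + 1) ^ k) x - quo ((1 + 1) ^ k) x'))) :=
  Rb_decay_uniform 3 1 le_rfl

end

end Summit.QuantumFields.BalabanUV.Beta.GAN24.WoodburyFibreProjectorZdDecay
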